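import Summits.BirchSwinnertonDyer.BirchSwinnertonDyer.Theorems.GenusKolyvaginAtTwoPowDvdShaCardAtTwoRTTwinShaLaddersOfDepthSupplies
import Summits.BirchSwinnertonDyer.BirchSwinnertonDyer.Theorems.GenusKolyvaginAtTwoPowDvdShaCardAtTwoRTRungSupplyIntrinsic
import Summits.BirchSwinnertonDyer.BirchSwinnertonDyer.Theorems.GenusKolyvaginAtTwoPowDvdShaCardAtTwoRTSuppliesFrame
import Summits.BirchSwinnertonDyer.BirchSwinnertonDyer.Theorems.GenusKolyvaginAtTwoPubInputsAtTwoDefs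
import Summits.BirchSwinnertonDyer.BirchSwinnertonDyer.Theorems.GenusKolyvaginAtTwoMinimalTwinBSDTwoBridges
import Summits.BirchSwinnertonDyer.BirchSwinnertonDyer.Theorems.AdditiveKolyvaginRoadBottomRankOneAdditiveClassOfPoint
import HarnessLib

/-!
# Route `GenusKolyvaginAtTwo`, LINE 18 (L_T `PowDvdShaCardAtTwoRT`, stmt-BirchSwinnertonDyer-23242), stub L
# `stub_twinShaLaddersAtTwo` — ITS CONCLUSION ON ITS OWN FRAME FROM ONE DISPLAYED K-SIDE HYPOTHESIS: Kolyvagin's minima with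
# McCallum's Prop. 5.2 at `2` in `kolyvaginClass` currency (+ which member of the ℚ-pair has rank `0`)

Seat `bsd-line-gk2-p2` g18 (PROVER seat 2/3, cell `bsd-f1-sign2`), `--supports stmt-BirchSwinnertonDyer-23242` (helper; closes
nothing). THEOREMS ONLY (no definition, no named fact, no `sorry`); BSD is not proved by any of this.

WHAT. `twinShaLadders_of_kolyvaginSuppliesAtTwo`: binders = those of stub L that the descent layer needs (`PubInputsAtTwo` — only its
Kolyvagin conjunct, for `rank E(K) = 1` —, Q2 `KolyvaginRelationAtTwo`, the habitat of `W`, `K`, `(Dt, β, ι, d₁)`, `y_1` non-torsion,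
`¬ 2^{M₀+1} ∣ P(1)`, the twin `Wd`), plus TWO displayed hypotheses:
(R0) the member of the ℚ-pair of sign `w(E)` has rank `0` and odd torsion (`w(E) = 1`: `W`; `w(E) = −1`: `Wd`) — Gross–Zagier–Kolyvagin
bookkeeping, left displayed; (KS) **Kolyvagin's minima with Prop. 5.2 at `2`**: for the non-trivial `τ ∈ Aut(K/ℚ)`, a level `L > M₀`,
depth minima `Mr` (antitone, `Mr 0 = M₀`, `Mr R = 0` — the bottom rung) and, at every depth with a positive drop, McCallum's Prop. 5.2
at `2` in the tree's own currency (`avoidance_of_kolyvaginSupply_intrinsic`'s `hP52`: odd depth `2m+1` — sign `w(E)`, budget `2m+1`,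
avoid `⟨u⟩`; even depth `2m+2` — sign `−w(E)`, budget `2m+1`, avoid `⟨u⟩ ⊔ ⟨c_L(1)⟩`). Conclusion = stub L's, VERBATIM. Everything between
(KS) and the conclusion — Selmer property (Gross 6.2 (1) at `2` + Q2), signs (Gross 5.4 at `2`), orders, the Kummer-kernel condition,
the `±` descent to `ℚ` and to the twin's model, the seeded greedy, the root-number interleaving of the ladder, the frame
(`E(K)[2^L] = 0`, generator of `E(K)` mod `2^L`, `y_K`, `c_L(1) = δ(y_K)`) — is kernel-checked in this seat's files.

References: [McCallumLMS1991] §5 p. 285, Prop. 5.2, Thm. 5.4 (p. 310); [GrossLMS1991] Thm. 1.3, §4 (4.1), (4.4), Prop. 5.3–5.4, Prop. 6.2;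
[Kolyvagin1990] Thm. A; [Kolyvagin1991MathAnn] Thm. 1.
-/

set_option autoImplicit false
-- the Theorems namespace of this sub repeats the summit name by design (D-0017 nested layout)
set_option linter.dupNamespace false

noncomputable section

open scoped Classical

namespace Summit.BirchSwinnertonDyer.BirchSwinnertonDyer.Theorems.GenusExact.PlusDescent

open WeierstrassCurve NumberField IsDedekindDomain Field Literature.NumberTheory.EllipticCurves
  Literature.NumberTheory.GaloisRepresentations Literature.NumberTheory.EllipticCurves.ModularForms AddSubgroup
open Summit.BirchSwinnertonDyer.BirchSwinnertonDyer.Theses.GenusKolyvaginAtTwo (KolyvaginRelationAtTwo)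

/-- **STUB L's CONCLUSION ON ITS OWN FRAME, MODULO (R0) + (KS).** See the module docstring. The displayed hypothesis `hKS` is, per
depth with a positive drop of the minima `Mr`, McCallum's Prop. 5.2 at `2` for Kolyvagin's classes `d.kolyvaginClass Nat.prime_two L`:
a square-free `n` of Kolyvagin primes of index `≥ L`, a datum `d` at `n`, «`2^{L−Mr(r−1)} c_L(e) = 0` for every datum `e` at every `n/ℓ`»
(the definition of `Mr (r−1)` as a minimum), `ord c_L(n) = 2^{L−Mr r}` (`2^{Mr r} ∥ P(n)`), the sign `−w(E)(−1)^{#primes} = ±w(E)`, and avoidance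
of the given classes (and of `c_L(1)` at even depth) by `⟨2^{L−Mr(r−1)} c_L(n)⟩`. [cite: McCallumLMS1991, §5 Prop. 5.2, Thm. 5.4 (p. 310)]
[cite: GrossLMS1991, Thm. 1.3, Prop. 5.4, Prop. 6.2] -/
theorem twinShaLadders_of_kolyvaginSuppliesAtTwo (hP : PubInputsAtTwo) (hQ2 : KolyvaginRelationAtTwo)
    (W : WeierstrassCurve ℚ) [W.IsElliptic] [W.IsGloballyMinimal] [NeZero (W.conductorNorm ℤ)] (hcm : ¬ W.HasCM)
    (hT : Odd W.tamagawaProduct) (K : Type) [Field K] [NumberField K] (hIQ : IsImaginaryQuadratic K)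
    (hodd : Odd (NumberField.discr K)) (h3 : NumberField.discr K ≠ -3) (hHe : SatisfiesHeegnerHypothesis (W.conductorNorm ℤ) K)
    (hρ : ∀ n : ℕ, 0 < n → W.HasSurjectiveModNGaloisRep ((2 : ℤ) ^ n))
    (Dt : ModularParametrizationData W (W.conductorNorm ℤ)) (β : ℤ) (ι : K →+* ℂ) (d₁ : KolyvaginHeegnerData Dt β ι 1)
    (hy : ¬ IsOfFinAddOrder d₁.derivedPoint) (M₀ : ℕ)
    (hndiv : ¬ ∃ Q : (W.baseChange (ringClassField K ι 1)).toAffine.Point, ((2 ^ (M₀ + 1) : ℕ) : ℤ) • Q = d₁.derivedPoint)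
    (Wd : WeierstrassCurve ℚ) [Wd.IsElliptic] (hTw : ∃ C : VariableChange ℚ, C • W.quadraticTwist (NumberField.discr K : ℚ) = Wd)
    (hR0 : (W.rootNumber = 1 ∧ W.mordellWeilRank = 0 ∧ Odd W.torsionOrder) ∨
      (W.rootNumber = -1 ∧ Wd.mordellWeilRank = 0 ∧ Odd Wd.torsionOrder))
    (hKS : ∀ τ : K ≃ₐ[ℚ] K, τ ≠ 1 → ∃ (L R : ℕ) (Mr : ℕ → ℕ), M₀ + 1 ≤ L ∧ (∀ j, Mr (j + 1) ≤ Mr j) ∧ Mr 0 = M₀ ∧ Mr R = 0 ∧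
      (∀ m : ℕ, Mr (2 * m + 1) < Mr (2 * m) →
        ∀ (i : ℕ) (u : Fin i → galH1Torsion (W.baseChange K) ((2 ^ L : ℕ) : ℤ)), i ≤ 2 * m + 1 →
        (∀ j, u j ∈ selmerGroup (W.baseChange K) ((2 ^ L : ℕ) : ℤ) ∧
          conjAct W τ ((2 ^ L : ℕ) : ℤ) (u j) = W.rootNumber • u j) →
        ∃ (n : ℕ) (_ : Squarefree n)
          (_ : ∀ ℓ ∈ n.primeFactors, Zhang2014.IsKolyvaginPrime (W.conductorNorm ℤ) W K 2 ℓ ∧ L ≤ Zhang2014.kolyvaginIndex W 2 ℓ)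
          (d : KolyvaginHeegnerData Dt β ι n),
          (∀ ℓ ∈ n.primeFactors, ∀ e : KolyvaginHeegnerData Dt β ι (n / ℓ),
            ((2 ^ (L - Mr (2 * m)) : ℕ) : ℤ) • e.kolyvaginClass Nat.prime_two L = 0) ∧
          addOrderOf (d.kolyvaginClass Nat.prime_two L) = 2 ^ (L - Mr (2 * m + 1)) ∧
          -W.rootNumber * (-1) ^ n.primeFactors.card = W.rootNumber ∧
          Disjoint (zmultiples (((2 ^ (L - Mr (2 * m)) : ℕ) : ℤ) • d.kolyvaginClass Nat.prime_two L))
            (AddSubgroup.closure (Set.range u))) ∧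
      (∀ m : ℕ, Mr (2 * m + 2) < Mr (2 * m + 1) →
        ∀ (i : ℕ) (u : Fin i → galH1Torsion (W.baseChange K) ((2 ^ L : ℕ) : ℤ)), i ≤ 2 * m + 1 →
        (∀ j, u j ∈ selmerGroup (W.baseChange K) ((2 ^ L : ℕ) : ℤ) ∧
          conjAct W τ ((2 ^ L : ℕ) : ℤ) (u j) = (-W.rootNumber) • u j) →
        ∃ (n : ℕ) (_ : Squarefree n)
          (_ : ∀ ℓ ∈ n.primeFactors, Zhang2014.IsKolyvaginPrime (W.conductorNorm ℤ) W K 2 ℓ ∧ L ≤ Zhang2014.kolyvaginIndex W 2 ℓ)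
          (d : KolyvaginHeegnerData Dt β ι n),
          (∀ ℓ ∈ n.primeFactors, ∀ e : KolyvaginHeegnerData Dt β ι (n / ℓ),
            ((2 ^ (L - Mr (2 * m + 1)) : ℕ) : ℤ) • e.kolyvaginClass Nat.prime_two L = 0) ∧
          addOrderOf (d.kolyvaginClass Nat.prime_two L) = 2 ^ (L - Mr (2 * m + 2)) ∧
          -W.rootNumber * (-1) ^ n.primeFactors.card = -W.rootNumber ∧
          Disjoint (zmultiples (((2 ^ (L - Mr (2 * m + 1)) : ℕ) : ℤ) • d.kolyvaginClass Nat.prime_two L))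
            (AddSubgroup.closure (Set.range u) ⊔ zmultiples (d₁.kolyvaginClass Nat.prime_two L)))) :
    ∃ (T : ℕ) (M : ℕ → ℕ), (∀ j, M (j + 1) ≤ M j) ∧ M 0 = M₀ ∧ M (2 * T) = 0 ∧
      (∀ m < T, ∃ x : Fin (2 * m + 2) → W.galH1, (∀ i, resBaseChange W K (x i) ∈ (W.baseChange K).sha) ∧
        (∀ i, addOrderOf (x i) = 2 ^ (M (2 * m) - M (2 * m + 1))) ∧
        ∀ c : Fin (2 * m + 2) → ℤ, ∑ i, c i • x i = 0 → ∀ i, ((2 ^ (M (2 * m) - M (2 * m + 1)) : ℕ) : ℤ) ∣ c i) ∧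
      (∀ m < T, ∃ x : Fin (2 * m + 2) → Wd.galH1, (∀ i, resBaseChange Wd K (x i) ∈ (Wd.baseChange K).sha) ∧
        (∀ i, addOrderOf (x i) = 2 ^ (M (2 * m + 1) - M (2 * m + 2))) ∧
        ∀ c : Fin (2 * m + 2) → ℤ, ∑ i, c i • x i = 0 → ∀ i, ((2 ^ (M (2 * m + 1) - M (2 * m + 2)) : ℕ) : ℤ) ∣ c i) := by
  have h2 : Module.finrank ℚ K = 2 := hIQ.1
  -- the conjugation of `K`
  obtain ⟨τ, -, hτ, -, -, -, -⟩ := exists_gal_ne_one_sqrt_discr (K := K) h2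
  obtain ⟨L, R, Mr, hML, hMr, hMr0, hMrR, hOdd, hEven⟩ := hKS τ hτ
  have hL1 : 1 ≤ L := by omega
  have hn : ((2 ^ L : ℕ) : ℤ) ≠ 0 := by positivity
  -- surjectivity currencies
  have hsurN : ∀ m : ℕ, W.HasSurjectiveModNGaloisRep ((2 ^ m : ℕ) : ℤ) :=
    MinimalTwinBSDTwo.forall_hasSurjectiveModNGaloisRep_two_pow_of_pos W hρ
  have hsurN' : ∀ m : ℕ, W.HasSurjectiveModNGaloisRep (2 ^ m : ℕ) := fun m ↦ by exact_mod_cast hsurN m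
  have hsurj1 : W.HasSurjectiveModNGaloisRep ((2 : ℤ) ^ 1) := hρ 1 one_pos
  -- `rank E(K) = 1` (Kolyvagin, the `.kolyvagin` conjunct of the published inputs)
  obtain ⟨Ph, hPh, hPhmap⟩ := AdditiveKoly.exists_isHeegnerPoint_map_eq_derivedPoint_one (W := W) (K := K) (Dt := Dt) (β := β)
    (ι := ι) hIQ hHe d₁
  have hnt : ¬ IsOfFinAddOrder Ph := fun h ↦ hy (by
    rw [← hPhmap]
    exact AddMonoidHom.isOfFinAddOrder _ h)
  have hrk1 : (W.baseChange K).mordellWeilRank = 1 := (hP.kolyvagin (W.conductorNorm ℤ) W K hIQ hHe hPh hnt).1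
  -- the frame at level `2^L`
  have hdiv : ∀ P : geomPoints (W.baseChange K), ∃ Q : geomPoints (W.baseChange K), ((2 ^ L : ℕ) : ℤ) • Q = P :=
    (W.baseChange K).zsmul_geomPoints_surjective_of_charZero hn
  obtain ⟨hL, g, P₀, hg, hP₀map, hP₀, hc1⟩ := exists_Kside_frame W Dt β ι hIQ hodd hHe hsurj1 hrk1.le d₁ hML hndiv hdiv
  -- the antitone minima in the large
  have hanti : ∀ a b, a ≤ b → Mr b ≤ Mr a := fun a b hab ↦ by
    induction hab with
    | refl => exact le_rfl
    | step _ ih => exact (hMr _).trans ih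
  have hMrL : ∀ j, Mr j ≤ L := fun j ↦ (hanti 0 j (Nat.zero_le j)).trans (by omega)
  -- (R0) in divisibility currency
  have hrank0 : (W.rootNumber = 1 ∧ ∀ P : W.toAffine.Point, ∃ Q : W.toAffine.Point, ((2 ^ L : ℕ) : ℤ) • Q = P) ∨
      (W.rootNumber = -1 ∧ ∀ P : Wd.toAffine.Point, ∃ Q : Wd.toAffine.Point, ((2 ^ L : ℕ) : ℤ) • Q = P) := by
    rcases hR0 with ⟨hw, hrk, htor⟩ | ⟨hw, hrk, htor⟩
    · refine Or.inl ⟨hw, fun P ↦ ?_⟩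
      convert exists_zsmul_two_pow_eq_of_rank_zero_of_odd_torsionOrder W hrk htor L P
    · refine Or.inr ⟨hw, fun P ↦ ?_⟩
      convert exists_zsmul_two_pow_eq_of_rank_zero_of_odd_torsionOrder Wd hrk htor L P
  refine twinShaLadders_of_depth_supplies W K h2 τ hτ L hdiv hL hTw hrank0 g hg P₀ hP₀ M₀ R Mr hMr hMr0 hMrR
    (fun m hlt i hi u hu hord ↦ ?_) (fun m hlt i hi u hu hord ↦ ?_)
  · -- odd depth `2m+1`: sign `w(E)`, no seed
    have h := avoidance_of_kolyvaginSupply_intrinsic W Dt β ι τ L hQ2 hcm hIQ h3 hodd hHe hT hsurN' hτ W.rootNumber hL1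
      (hMr (2 * m)) (hMrL (2 * m)) ⊥
      (fun i u hi hu ↦ by
        obtain ⟨n, hn', hKol, d, hsub, hordc, hsign, hdisj⟩ := hOdd m hlt i u hi hu
        exact ⟨n, hn', hKol, d, hsub, hordc, hsign, by rwa [sup_bot_eq]⟩)
      i hi u hu hord
    obtain ⟨y, hPy, hyord, hyav⟩ := h
    exact ⟨y, hPy, hyord, by rwa [sup_bot_eq] at hyav⟩
  · -- even depth `2m+2`: sign `−w(E)`, seed `⟨δ(P₀)⟩ = ⟨c_L(1)⟩`
    have h := avoidance_of_kolyvaginSupply_intrinsic W Dt β ι τ L hQ2 hcm hIQ h3 hodd hHe hT hsurN' hτ (-W.rootNumber) hL1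
      (hMr (2 * m + 1)) (hMrL (2 * m + 1)) (zmultiples (kummerMapTorsion (W.baseChange K) ((2 ^ L : ℕ) : ℤ) hdiv P₀))
      (fun i u hi hu ↦ by
        obtain ⟨n, hn', hKol, d, hsub, hordc, hsign, hdisj⟩ := hEven m hlt i u hi hu
        exact ⟨n, hn', hKol, d, hsub, hordc, hsign, by rwa [hc1] at hdisj⟩)
      i hi u hu hord
    exact h

end Summit.BirchSwinnertonDyer.BirchSwinnertonDyer.Theorems.GenusExact.PlusDescent

end
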